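import Literature.Claims.NS.Baev2022
import Literature.Analysis.FluidPDE.BeltramiFlows
import Literature.Analysis.FluidPDE.LeraySchemePressure
import HarnessLib

/-!
# C113 `Baev2022` — the printed intermediate steps (12) and Corollary 2 are false:
# the viscous ABC flow has non-harmonic pressure and a non-vanishing convective term

Kernel refutations of `Literature.Claims.NS.Baev2022.Eq12` (formula (12) p.8: `Δp = 0` for
every classical Navier–Stokes solution) and `Literature.Claims.NS.Baev2022.Cor2` (Следствие 2
p.10: `Σₖ vₖ ∂ₖv = 0` for every classical solution).

Witness for both: the viscous Arnold–Beltrami–Childress flow `u(t,x) = e^{−t} v(x)`,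
`p(t,x) = −½ e^{−2t} |v(x)|²`, `v = abc 1 1 1` (tree: `isClassicalNSSolutionOn_abc`), a classical
solution on `ℝ³ × ℝ`, restricted to `[0,1]`. At `t = 0`:
`((v·∇)v)(0)₀ = 1 ≠ 0`, and at `x⋆ = (π/2, 0, 0)` the pressure Poisson equation (Tao 2011 (8),
tree `laplacian_pressure_eq_of_isClassicalNSSolutionOn`) gives
`Δp(0, x⋆) = −div((v·∇)v)(x⋆) = −tr((∇v(x⋆))²) = 2 ≠ 0`.
(The ABC flow is bounded, not decaying: it tests the sentences (12) and Corollary 2 as printed —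
"for classical solutions" — which the paper asserts before any decay class enters; the in-class
failure of the theorem itself is `not_ClaimedTheorem` in `SoloRefuteBaev2022.lean`.)
All statements proved ([folklore]); axioms `propext`, `Classical.choice`, `Quot.sound`.
Refuter: ns-claims-refuter-1; filed under convention (b) by the paired salvage prover.

WHAT THIS IS NOT: not a claim about NS regularity or blow-up; not a claim about any author beyond
the typed locator.
-/

set_option linter.dupNamespace false

noncomputable section

open Set Function Filter Topology Real
open scoped ContDiff Laplacian InnerProductSpace RealInnerProductSpace
open Literature.Analysis.FluidPDE Literature.Analysis.FluidPDE.ABC Literature.Claims.NS.Baev2022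

namespace Summit.NavierStokesRegularity.NavierStokesRegularity.Theorems.Baev2022

/-! ## A. The ABC flow at the origin: `((v·∇)v)(0)₀ = 1` -/

/-- `v(0) = (1, 1, 1)` for the ABC flow `A = B = C = 1`. [folklore] -/
theorem abc_origin_eq :
    abc 1 1 1 (0 : E3) = EuclideanSpace.single 0 (1 : ℝ) + EuclideanSpace.single 1 (1 : ℝ) +
      EuclideanSpace.single 2 (1 : ℝ) := by
  ext i
  fin_cases i <;> simp

/-- The first component of `(v·∇)v` at the origin is `v₀∂₀v₀ + v₁∂₁v₀ + v₂∂₂v₀ = 0 + 0 + 1`.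
[folklore] -/
theorem convect_abc_origin_apply_zero : convect (abc 1 1 1) (abc 1 1 1) (0 : E3) 0 = 1 := by
  show fderiv ℝ (abc 1 1 1) 0 (abc 1 1 1 0) 0 = 1
  rw [abc_origin_eq, map_add, map_add, PiLp.add_apply, PiLp.add_apply, fderiv_abc_single,
    fderiv_abc_single, fderiv_abc_single]
  simp [jac]

/-- **Corollary 2 is false**: the viscous ABC flow is a classical Navier–Stokes solution on
`[0,1]` whose convective term does not vanish (`((v·∇)v)(0,0)₀ = 1`).
[cite: Baev2022ru, Следствие 2 p.10] -/
theorem not_Cor2 : ¬ Literature.Claims.NS.Baev2022.Cor2 := by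
  intro h
  have hsol := (isClassicalNSSolutionOn_abc 1 1 1 1).mono (subset_univ (Icc (0 : ℝ) 1))
    (uniqueDiffOn_Icc one_pos)
  have h0 := h 1 one_pos 1 one_pos _ _ hsol 0 ⟨le_rfl, zero_le_one⟩ 0
  rw [strongBeltramiVelocity_zero] at h0
  have h00 := congrArg (fun w : E3 => w 0) h0
  simp only [convect_abc_origin_apply_zero, PiLp.zero_apply] at h00
  exact one_ne_zero h00

/-! ## B. The ABC flow at `x⋆ = (π/2, 0, 0)`: `div((v·∇)v)(x⋆) = −2` -/

/-- The point `x⋆ = (π/2, 0, 0)`. [folklore] -/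
def xs : E3 := (π / 2) • EuclideanSpace.single 0 (1 : ℝ)

/-- Coordinates of `x⋆`. [folklore] -/
@[simp] theorem xs_apply_zero : xs 0 = π / 2 := by simp [xs]

/-- Coordinates of `x⋆`. [folklore] -/
@[simp] theorem xs_apply_one : xs 1 = 0 := by simp [xs]

/-- Coordinates of `x⋆`. [folklore] -/
@[simp] theorem xs_apply_two : xs 2 = 0 := by simp [xs]

/-- `∇v(x⋆) e₀ = −e₂`. [folklore] -/
theorem fderiv_abc_xs_single_zero :
    fderiv ℝ (abc 1 1 1) xs (EuclideanSpace.single 0 (1 : ℝ)) =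
      -EuclideanSpace.single 2 (1 : ℝ) := by
  ext i
  rw [fderiv_abc_single]
  fin_cases i <;> simp [jac]

/-- `∇v(x⋆) e₁ = e₂`. [folklore] -/
theorem fderiv_abc_xs_single_one :
    fderiv ℝ (abc 1 1 1) xs (EuclideanSpace.single 1 (1 : ℝ)) =
      EuclideanSpace.single 2 (1 : ℝ) := by
  ext i
  rw [fderiv_abc_single]
  fin_cases i <;> simp [jac]

/-- `∇v(x⋆) e₂ = e₀`. [folklore] -/
theorem fderiv_abc_xs_single_two :
    fderiv ℝ (abc 1 1 1) xs (EuclideanSpace.single 2 (1 : ℝ)) =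
      EuclideanSpace.single 0 (1 : ℝ) := by
  ext i
  rw [fderiv_abc_single]
  fin_cases i <;> simp [jac]

/-- **`div((v·∇)v)(x⋆) = tr((∇v(x⋆))²) = −2`** (the ABC flow is divergence free, so
`div((v·∇)v) = Σⱼ ⟪eⱼ, ∇v(∇v eⱼ)⟫`). [folklore] -/
theorem divergence_convect_abc_xs :
    VectorCalculus.divergence (convect (abc 1 1 1) (abc 1 1 1)) xs = -2 := by
  rw [divergence_convect_eq_sum (EuclideanSpace.basisFun (Fin 3) ℝ) (contDiff_abc 1 1 1)
    (contDiff_abc 1 1 1) (isDivFree_abc 1 1 1) xs]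
  simp only [Fin.sum_univ_three, EuclideanSpace.basisFun_apply, fderiv_abc_xs_single_zero,
    fderiv_abc_xs_single_one, fderiv_abc_xs_single_two, map_neg]
  simp [EuclideanSpace.inner_single_left]
  norm_num

/-- The divergence of the zero vector field vanishes. [folklore] -/
theorem divergence_zeroField (x : E3) :
    VectorCalculus.divergence (fun _ : E3 => (0 : E3)) x = 0 := by
  rw [divergence_eq_sum_inner_fderiv (EuclideanSpace.basisFun (Fin 3) ℝ)]
  simp

/-- **Formula (12) is false**: the viscous ABC flow is a classical Navier–Stokes solution on
`[0,1]` whose pressure is not harmonic: `Δp(0, x⋆) = −div((v·∇)v)(x⋆) = 2`.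
[cite: Baev2022ru, (12) p.8; Теорема 1 p.9] -/
theorem not_Eq12 : ¬ Literature.Claims.NS.Baev2022.Eq12 := by
  intro h
  have hglob := isClassicalNSSolutionOn_abc 1 1 1 1
  have hsol := hglob.mono (subset_univ (Icc (0 : ℝ) 1)) (uniqueDiffOn_Icc one_pos)
  have h12 := h 1 one_pos 1 one_pos _ _ hsol 0 ⟨le_rfl, zero_le_one⟩ xs
  have hint : (0 : ℝ) ∈ interior (univ : Set ℝ) := by simp
  have hP := laplacian_pressure_eq_of_isClassicalNSSolutionOn hglob hint xs
  have hf : VectorCalculus.divergence ((0 : ℝ → E3 → E3) 0) xs = 0 := divergence_zeroField xs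
  rw [h12, strongBeltramiVelocity_zero, divergence_convect_abc_xs, hf] at hP
  norm_num at hP

end Summit.NavierStokesRegularity.NavierStokesRegularity.Theorems.Baev2022

end

-- WHAT THIS IS NOT: not a claim about NS regularity or blow-up; not a claim about any author
-- beyond the typed locator.
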